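import Literature.Topology.FourManifolds.GompfAxisTwist
import HarnessLib

/-!
# Axial straightenings: realising near-identity linear maps fixing an axis on a tube around it

Infrastructure for the framed form of R. Gompf, *More Cappell–Shaneson spheres are standard*,
Algebr. Geom. Topol. 10 (2010), Theorem 2.1 (the named fact
`Literature.Topology.FourManifolds.gompf2010_framedTwist`): to compare the straightened monodromy
of an arbitrary matrix `B` in Gompf's standard form with a fixed model on a tube around the first
coordinate circle `α` one has to realise the linear map `B⁻¹ M₀` — which fixes `α` — by a based
diffeotopy of `T³` that is *exactly linear on a whole tube around `α`* (not only near the base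
point). This file is the tube-supported, axis-equivariant analogue of the ball-supported
straightening machinery of `FibreStraightening.lean` / `GompfStraighteningExistence.lean`
(Hirsch, *Differential Topology*, Ch. 8 §3, proof of Thm 3.1: inserting a bump function):

* `Literature.Topology.FourManifolds.axisPerp` — the projection of `ℝ³` off the axis `e₀`
  (`‖axisPerp v‖² = v₁² + v₂²`, the distance from the axis used by `Diffeotopy.torusExtendTube`);
  `Literature.Topology.FourManifolds.IsAxial L :⟺ L e₀ = e₀`;
* `Literature.Topology.FourManifolds.axialFun ρ L y = y + χ(axisPerp y / ρ) (L y - y)` — equal to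
  `L` on the tube `‖axisPerp y‖ ≤ 3ρ`, to the identity off `‖axisPerp y‖ ≥ (17/5) ρ`, commuting with
  the translations along the axis for axial `L`, `C¹`-close to the identity
  (`norm_fderiv_axialFun_sub_id_le`) and hence a diffeomorphism of `ℝ³` for `‖L - 1‖` below the
  straightening threshold (`Literature.Topology.FourManifolds.axialDiffeo`);
* `Literature.Topology.FourManifolds.axialListFun`, `Literature.Topology.FourManifolds.axialPathFun`
  — iterated axial straightenings of a list and of its segment list at time `t` (jointly smooth, the
  identity at `t = 0` and off the tube of radius `(17/5) ρ`, preserving the tube of radius `4ρ`, and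
  **exactly linear with operator `segProd l t` on the tube of radius `3ρ (6/7)^{|l|}`**, resp. of
  radius `3ρ` when all factors are contractions, `axialPathFun_of_norm_le`,
  `axialListFun_of_norm_le_of_contracting`);
* `Literature.Topology.FourManifolds.axialDiffeotopy` (on `ℝ³`) and
  `Literature.Topology.FourManifolds.torusAxialDiffeotopy` (on `T³`, via `torusExtendTube`, for
  `4ρ < π`), with its exponential-coordinate formula.

Everything here is proved; no named facts are introduced.

## References

* M. W. Hirsch, *Differential Topology*, GTM 33 (1976), Ch. 8 §1 and §3 (proof of Thm 3.1).
  [Hirsch1976]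
* R. E. Gompf, *More Cappell–Shaneson spheres are standard*, Algebr. Geom. Topol. 10 (2010)
  1665–1681, §4 ¶3. [GompfAGT2010]
-/

open scoped Manifold ContDiff Topology Real
open Set Function Metric

noncomputable section

namespace Literature.Topology.FourManifolds

/-- Local notation: `𝔼 n` is the model Euclidean space `EuclideanSpace ℝ (Fin n)`. -/
local notation "𝔼 " n:arg => EuclideanSpace ℝ (Fin n)

/-- Local notation: the model with corners `𝓣 = (𝓡 1).prod ((𝓡 1).prod (𝓡 1))` of `ThreeTorus`. -/
local notation "𝓣" =>
  (ModelWithCorners.prod (𝓡 1) (ModelWithCorners.prod (𝓡 1) (𝓡 1)))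

/-! ### The projection off the axis and axial operators -/

section Perp

/-- **The projection of `ℝ³` off the axis `e₀`**: `v ↦ v - v₀ e₀ = (0, v₁, v₂)`. [folklore] -/
def axisPerp : 𝔼 3 →L[ℝ] 𝔼 3 :=
  ContinuousLinearMap.id ℝ (𝔼 3) - (EuclideanSpace.proj (0 : Fin 3)).smulRight axisVec

/-- The projection, pointwise. [folklore] -/
theorem axisPerp_apply (v : 𝔼 3) : axisPerp v = v - v 0 • axisVec := rfl

/-- The axis coordinate of the projection vanishes. [folklore] -/
@[simp] theorem axisPerp_apply_zero (v : 𝔼 3) : axisPerp v 0 = 0 := by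
  simp [axisPerp_apply]

/-- The projection keeps the first normal coordinate. [folklore] -/
@[simp] theorem axisPerp_apply_one (v : 𝔼 3) : axisPerp v 1 = v 1 := by
  simp [axisPerp_apply]

/-- The projection keeps the second normal coordinate. [folklore] -/
@[simp] theorem axisPerp_apply_two (v : 𝔼 3) : axisPerp v 2 = v 2 := by
  simp [axisPerp_apply]

/-- **`‖axisPerp v‖² = v₁² + v₂²`**, the squared distance from the axis. [folklore] -/
theorem norm_axisPerp_sq (v : 𝔼 3) : ‖axisPerp v‖ ^ 2 = v 1 ^ 2 + v 2 ^ 2 := by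
  rw [EuclideanSpace.norm_eq, Real.sq_sqrt (by positivity), Fin.sum_univ_three]
  simp [sq_abs]

/-- `‖v‖² = v₀² + v₁² + v₂²`. [folklore] -/
theorem norm_sq_eq_three (v : 𝔼 3) : ‖v‖ ^ 2 = v 0 ^ 2 + v 1 ^ 2 + v 2 ^ 2 := by
  rw [EuclideanSpace.norm_eq, Real.sq_sqrt (by positivity), Fin.sum_univ_three]
  simp [sq_abs]

/-- The projection does not increase the norm. [folklore] -/
theorem norm_axisPerp_le (v : 𝔼 3) : ‖axisPerp v‖ ≤ ‖v‖ := by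
  apply le_of_sq_le_sq _ (norm_nonneg _)
  rw [norm_axisPerp_sq, norm_sq_eq_three]
  nlinarith [sq_nonneg (v 0)]

/-- The operator norm of the projection is at most `1`. [folklore] -/
theorem opNorm_axisPerp_le : ‖axisPerp‖ ≤ 1 :=
  ContinuousLinearMap.opNorm_le_bound _ zero_le_one fun v ↦ by rw [one_mul]; exact norm_axisPerp_le v

/-- The projection kills the axis vector. [folklore] -/
@[simp] theorem axisPerp_axisVec : axisPerp axisVec = 0 := by
  ext i
  fin_cases i <;> simp

/-- **The projection is invariant under the translations along the axis.** [folklore] -/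
theorem axisPerp_add_smul_axisVec (v : 𝔼 3) (c : ℝ) : axisPerp (v + c • axisVec) = axisPerp v := by
  rw [map_add, map_smul, axisPerp_axisVec, smul_zero, add_zero]

/-- `v = axisPerp v + v₀ e₀`. [folklore] -/
theorem axisPerp_add_eq (v : 𝔼 3) : axisPerp v + v 0 • axisVec = v := by
  rw [axisPerp_apply, sub_add_cancel]

/-- **Axial operators**: continuous linear maps of `ℝ³` fixing the axis vector `e₀`. [folklore] -/
def IsAxial (L : 𝔼 3 →L[ℝ] 𝔼 3) : Prop := L axisVec = axisVec

namespace IsAxial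

variable {L M : 𝔼 3 →L[ℝ] 𝔼 3}

/-- The identity is axial. [folklore] -/
theorem one : IsAxial (1 : 𝔼 3 →L[ℝ] 𝔼 3) := rfl

/-- Products of axial operators are axial. [folklore] -/
theorem mul (hL : IsAxial L) (hM : IsAxial M) : IsAxial (L * M) := by
  show L (M axisVec) = axisVec
  rw [hM, hL]

/-- Segment operators of axial operators are axial. [folklore] -/
theorem segOp (hL : IsAxial L) (κ : ℝ) : IsAxial (segOp κ L) := by
  show axisVec + κ • (L axisVec - axisVec) = axisVec
  rw [hL, sub_self, smul_zero, add_zero]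

/-- **An axial operator commutes with the translations along the axis.** [folklore] -/
theorem apply_add_smul (hL : IsAxial L) (v : 𝔼 3) (c : ℝ) : L (v + c • axisVec) = L v + c • axisVec := by
  rw [map_add, map_smul, hL]

/-- `L v - v = (L - 1) (axisPerp v)` for axial `L`. [folklore] -/
theorem sub_apply (hL : IsAxial L) (v : 𝔼 3) : L v - v = (L - 1) (axisPerp v) := by
  conv_lhs => rw [← axisPerp_add_eq v]
  rw [hL.apply_add_smul]
  show _ = L (axisPerp v) - axisPerp v
  abel

/-- `‖L v - v‖ ≤ ‖L - 1‖ ‖axisPerp v‖` for axial `L`. [folklore] -/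
theorem norm_sub_apply_le (hL : IsAxial L) (v : 𝔼 3) : ‖L v - v‖ ≤ ‖L - 1‖ * ‖axisPerp v‖ := by
  rw [hL.sub_apply]
  exact (L - 1).le_opNorm _

/-- The projection of `L v` only depends on the projection of `v`. [folklore] -/
theorem axisPerp_apply (hL : IsAxial L) (v : 𝔼 3) : axisPerp (L v) = axisPerp (L (axisPerp v)) := by
  conv_lhs => rw [← axisPerp_add_eq v, hL.apply_add_smul, axisPerp_add_smul_axisVec]

/-- `‖axisPerp (L v)‖ ≤ ‖L‖ ‖axisPerp v‖` for axial `L`. [folklore] -/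
theorem norm_axisPerp_apply_le (hL : IsAxial L) (v : 𝔼 3) : ‖axisPerp (L v)‖ ≤ ‖L‖ * ‖axisPerp v‖ := by
  rw [hL.axisPerp_apply]
  exact (norm_axisPerp_le _).trans (L.le_opNorm _)

end IsAxial

/-- Products of lists of axial operators are axial. [folklore] -/
theorem isAxial_list_prod {l : List (𝔼 3 →L[ℝ] 𝔼 3)} (hl : ∀ L ∈ l, IsAxial L) : IsAxial l.prod := by
  induction l with
  | nil => exact IsAxial.one
  | cons L l ih =>
    rw [List.prod_cons]
    exact (hl L List.mem_cons_self).mul (ih fun M hM ↦ hl M (List.mem_cons_of_mem _ hM))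

/-- Members of the segment list of a list of axial operators are axial. [folklore] -/
theorem isAxial_of_mem_segList {l : List (𝔼 3 →L[ℝ] 𝔼 3)} (hl : ∀ L ∈ l, IsAxial L) (t : ℝ) :
    ∀ L ∈ segList l t, IsAxial L := by
  intro L hL
  obtain ⟨N, hN, rfl⟩ := List.mem_map.1 hL
  exact (hl N hN).segOp _

/-- `‖axisPerp (l.prod v)‖ ≤ (7/6)^{|l|} ‖axisPerp v‖` for axial factors of norm `≤ 7/6`. [folklore] -/
theorem norm_axisPerp_list_prod_le {l : List (𝔼 3 →L[ℝ] 𝔼 3)} (hl : ∀ L ∈ l, IsAxial L)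
    (h : ∀ L ∈ l, ‖L‖ ≤ 7 / 6) (v : 𝔼 3) :
    ‖axisPerp (l.prod v)‖ ≤ (7 / 6) ^ l.length * ‖axisPerp v‖ := by
  induction l with
  | nil => simp
  | cons L l ih =>
    have hl' : ∀ M ∈ l, IsAxial M := fun M hM ↦ hl M (List.mem_cons_of_mem _ hM)
    have h' : ∀ M ∈ l, ‖M‖ ≤ 7 / 6 := fun M hM ↦ h M (List.mem_cons_of_mem _ hM)
    rw [List.prod_cons, List.length_cons, pow_succ']
    show ‖axisPerp (L (l.prod v))‖ ≤ _
    calc ‖axisPerp (L (l.prod v))‖ ≤ ‖L‖ * ‖axisPerp (l.prod v)‖ :=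
          (hl L List.mem_cons_self).norm_axisPerp_apply_le _
      _ ≤ (7 / 6) * ((7 / 6) ^ l.length * ‖axisPerp v‖) :=
          mul_le_mul (h L List.mem_cons_self) (ih hl' h') (norm_nonneg _) (by norm_num)
      _ = 7 / 6 * (7 / 6) ^ l.length * ‖axisPerp v‖ := by ring

/-- `‖axisPerp (l.prod v)‖ ≤ ‖axisPerp v‖` for axial factors of norm `≤ 1`. [folklore] -/
theorem norm_axisPerp_list_prod_le_of_contracting {l : List (𝔼 3 →L[ℝ] 𝔼 3)} (hl : ∀ L ∈ l, IsAxial L)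
    (h : ∀ L ∈ l, ‖L‖ ≤ 1) (v : 𝔼 3) : ‖axisPerp (l.prod v)‖ ≤ ‖axisPerp v‖ := by
  induction l with
  | nil => simp
  | cons L l ih =>
    have hl' : ∀ M ∈ l, IsAxial M := fun M hM ↦ hl M (List.mem_cons_of_mem _ hM)
    have h' : ∀ M ∈ l, ‖M‖ ≤ 1 := fun M hM ↦ h M (List.mem_cons_of_mem _ hM)
    rw [List.prod_cons]
    show ‖axisPerp (L (l.prod v))‖ ≤ _
    calc ‖axisPerp (L (l.prod v))‖ ≤ ‖L‖ * ‖axisPerp (l.prod v)‖ :=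
          (hl L List.mem_cons_self).norm_axisPerp_apply_le _
      _ ≤ 1 * ‖axisPerp v‖ := mul_le_mul (h L List.mem_cons_self) (ih hl' h') (norm_nonneg _) zero_le_one
      _ = ‖axisPerp v‖ := one_mul _

end Perp

/-! ### The axial straightening of one operator -/

section Axial

variable {ρ : ℝ}

/-- **The axial straightening** `y ↦ y + χ(axisPerp y / ρ) (L y - y)` of a continuous linear map
`L` (`χ = coreBump`, `rIn = 3`, `rOut = 17/5`): equal to `L` on the tube `‖axisPerp y‖ ≤ 3ρ` around
the axis, to the identity off the tube `‖axisPerp y‖ ≥ (17/5) ρ`. [cite: Hirsch1976, Ch. 8 §3, proof of Thm 3.1 (inserting a bump function)] -/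
def axialFun (ρ : ℝ) (L : 𝔼 3 →L[ℝ] 𝔼 3) (y : 𝔼 3) : 𝔼 3 :=
  y + cutAt coreBump ρ (axisPerp y) • (L y - y)

/-- **On the inner tube the axial straightening is `L`.** [folklore] -/
theorem axialFun_of_norm_le (hρ : 0 < ρ) (L : 𝔼 3 →L[ℝ] 𝔼 3) {y : 𝔼 3} (hy : ‖axisPerp y‖ ≤ ρ * 3) :
    axialFun ρ L y = L y := by
  have h : cutAt coreBump ρ (axisPerp y) = 1 := cutAt_eq_one coreBump hρ hy
  rw [axialFun, h, one_smul, add_sub_cancel]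

/-- **Off the outer tube the axial straightening is the identity.** [folklore] -/
theorem axialFun_of_le_norm (hρ : 0 < ρ) (L : 𝔼 3 →L[ℝ] 𝔼 3) {y : 𝔼 3} (hy : ρ * (17 / 5) ≤ ‖axisPerp y‖) :
    axialFun ρ L y = y := by
  have h : cutAt coreBump ρ (axisPerp y) = 0 := cutAt_eq_zero coreBump hρ hy
  rw [axialFun, h, zero_smul, add_zero]

/-- The axial straightening of the identity is the identity. [folklore] -/
@[simp] theorem axialFun_one (ρ : ℝ) : axialFun ρ (1 : 𝔼 3 →L[ℝ] 𝔼 3) = id := by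
  funext y
  simp [axialFun]

/-- The axial straightening fixes `0`. [folklore] -/
@[simp] theorem axialFun_apply_zero (ρ : ℝ) (L : 𝔼 3 →L[ℝ] 𝔼 3) : axialFun ρ L 0 = 0 := by
  simp [axialFun]

/-- **The axial straightening of an axial operator commutes with the translations along the
axis.** [folklore] -/
theorem axialFun_add_smul_axisVec {L : 𝔼 3 →L[ℝ] 𝔼 3} (hL : IsAxial L) (y : 𝔼 3) (c : ℝ) :
    axialFun ρ L (y + c • axisVec) = axialFun ρ L y + c • axisVec := by
  rw [axialFun, axialFun, axisPerp_add_smul_axisVec, hL.apply_add_smul,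
    show L y + c • axisVec - (y + c • axisVec) = L y - y by abel]
  abel

/-- The projection of the axial straightening. [folklore] -/
theorem axisPerp_axialFun {L : 𝔼 3 →L[ℝ] 𝔼 3} (hL : IsAxial L) (y : 𝔼 3) :
    axisPerp (axialFun ρ L y) = axisPerp y + cutAt coreBump ρ (axisPerp y) • axisPerp ((L - 1) (axisPerp y)) := by
  rw [axialFun, map_add, map_smul, hL.sub_apply]

/-- The axial straightening of a near-identity axial operator expands the distance from the axis by
at most `7/6`. [folklore] -/
theorem norm_axisPerp_axialFun_le {L : 𝔼 3 →L[ℝ] 𝔼 3} (hL : IsAxial L) (hL1 : ‖L - 1‖ ≤ 1 / 6) (y : 𝔼 3) :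
    ‖axisPerp (axialFun ρ L y)‖ ≤ (7 / 6) * ‖axisPerp y‖ := by
  rw [axisPerp_axialFun hL]
  refine (norm_add_le _ _).trans ?_
  have h1 : ‖cutAt coreBump ρ (axisPerp y) • axisPerp ((L - 1) (axisPerp y))‖ ≤ (1 / 6) * ‖axisPerp y‖ := by
    rw [norm_smul, Real.norm_eq_abs]
    calc |cutAt coreBump ρ (axisPerp y)| * ‖axisPerp ((L - 1) (axisPerp y))‖
        ≤ 1 * (‖L - 1‖ * ‖axisPerp y‖) :=
          mul_le_mul (abs_cutAt_le coreBump _) ((norm_axisPerp_le _).trans ((L - 1).le_opNorm _))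
            (norm_nonneg _) zero_le_one
      _ ≤ 1 * ((1 / 6) * ‖axisPerp y‖) := by
          rw [one_mul, one_mul]; exact mul_le_mul_of_nonneg_right hL1 (norm_nonneg _)
      _ = (1 / 6) * ‖axisPerp y‖ := one_mul _
  linarith

/-- **The axial straightening preserves the tubes of radius at least `(7/6)(17/5) ρ`**: the
distance from the axis of the image is at most `max (‖axisPerp y‖) ((7/6)(17/5) ρ)`. [folklore] -/
theorem norm_axisPerp_axialFun_le_max (hρ : 0 < ρ) {L : 𝔼 3 →L[ℝ] 𝔼 3} (hL : IsAxial L)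
    (hL1 : ‖L - 1‖ ≤ 1 / 6) (y : 𝔼 3) :
    ‖axisPerp (axialFun ρ L y)‖ ≤ max ‖axisPerp y‖ ((7 / 6) * (ρ * (17 / 5))) := by
  by_cases hy : ρ * (17 / 5) ≤ ‖axisPerp y‖
  · rw [axialFun_of_le_norm hρ L hy]
    exact le_max_left _ _
  · exact (norm_axisPerp_axialFun_le hL hL1 y).trans ((mul_le_mul_of_nonneg_left (not_le.1 hy).le
      (by norm_num)).trans (le_max_right _ _))

/-- **The axial straightening is jointly smooth in `(L, y)`.** [folklore] -/
theorem contDiff_axialFun_uncurry (ρ : ℝ) :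
    ContDiff ℝ ∞ fun p : (𝔼 3 →L[ℝ] 𝔼 3) × (𝔼 3) ↦ axialFun ρ p.1 p.2 := by
  unfold axialFun
  have h1 : ContDiff ℝ ∞ fun p : (𝔼 3 →L[ℝ] 𝔼 3) × (𝔼 3) ↦ cutAt coreBump ρ (axisPerp p.2) :=
    (contDiff_cutAt coreBump).comp (axisPerp.contDiff.comp contDiff_snd)
  have h2 : ContDiff ℝ ∞ fun p : (𝔼 3 →L[ℝ] 𝔼 3) × (𝔼 3) ↦ p.1 p.2 := isBoundedBilinearMap_apply.contDiff
  exact contDiff_snd.add (h1.smul (h2.sub contDiff_snd))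

/-- The axial straightening is smooth. [folklore] -/
theorem contDiff_axialFun (ρ : ℝ) (L : 𝔼 3 →L[ℝ] 𝔼 3) : ContDiff ℝ ∞ (axialFun ρ L) :=
  (contDiff_axialFun_uncurry ρ).comp (contDiff_const.prodMk contDiff_id)

/-- The derivative of the axial straightening. [folklore] -/
theorem hasFDerivAt_axialFun (ρ : ℝ) (L : 𝔼 3 →L[ℝ] 𝔼 3) (y : 𝔼 3) :
    HasFDerivAt (axialFun ρ L)
      (ContinuousLinearMap.id ℝ (𝔼 3) + (cutAt coreBump ρ (axisPerp y) • (L - ContinuousLinearMap.id ℝ (𝔼 3)) +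
        ((fderiv ℝ (cutAt coreBump ρ) (axisPerp y)).comp axisPerp).smulRight (L y - y))) y := by
  have hc : HasFDerivAt (fun y ↦ cutAt coreBump ρ (axisPerp y))
      ((fderiv ℝ (cutAt coreBump ρ) (axisPerp y)).comp axisPerp) y :=
    (((contDiff_cutAt coreBump).differentiable (by simp) (axisPerp y)).hasFDerivAt).comp y axisPerp.hasFDerivAt
  have hL : HasFDerivAt (fun y ↦ L y - y) (L - ContinuousLinearMap.id ℝ (𝔼 3)) y :=
    L.hasFDerivAt.sub (hasFDerivAt_id y)
  exact (hasFDerivAt_id y).add (hc.smul hL)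

/-- **The axial straightening of an axial operator is `C¹`-close to the identity**:
`‖D(axialFun) - id‖ ≤ (1 + C (17/5)) ‖L - 1‖`, `C = bumpBound coreBump` (on the support of the cut-off
`‖L y - y‖ ≤ ‖L - 1‖ ‖axisPerp y‖ ≤ ‖L - 1‖ (17/5) ρ`). [cite: Hirsch1976, Ch. 8 §3, proof of Thm 3.1 (inserting a bump function)] -/
theorem norm_fderiv_axialFun_sub_id_le (hρ : 0 < ρ) {L : 𝔼 3 →L[ℝ] 𝔼 3} (hL : IsAxial L) (y : 𝔼 3) :
    ‖fderiv ℝ (axialFun ρ L) y - ContinuousLinearMap.id ℝ (𝔼 3)‖ ≤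
      (1 + bumpBound (coreBump (E := 𝔼 3)) * (17 / 5)) * ‖L - 1‖ := by
  rw [(hasFDerivAt_axialFun ρ L y).fderiv, add_sub_cancel_left]
  have hC := bumpBound_nonneg (coreBump (E := 𝔼 3))
  have hOut : (coreBump (E := 𝔼 3)).rOut = 17 / 5 := rfl
  have hL1 : ‖L - 1‖ = ‖L - ContinuousLinearMap.id ℝ (𝔼 3)‖ := rfl
  by_cases hy : ‖axisPerp y‖ ≤ ρ * (17 / 5)
  · refine (norm_add_le _ _).trans ?_
    have h1 : ‖cutAt coreBump ρ (axisPerp y) • (L - ContinuousLinearMap.id ℝ (𝔼 3))‖ ≤ ‖L - 1‖ := by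
      rw [norm_smul, hL1]
      exact mul_le_of_le_one_left (norm_nonneg _) (abs_cutAt_le coreBump _)
    have h2 : ‖((fderiv ℝ (cutAt coreBump ρ) (axisPerp y)).comp axisPerp).smulRight (L y - y)‖ ≤
        bumpBound (coreBump (E := 𝔼 3)) * (17 / 5) * ‖L - 1‖ := by
      rw [ContinuousLinearMap.norm_smulRight_apply]
      have h3 : ‖(fderiv ℝ (cutAt coreBump ρ) (axisPerp y)).comp axisPerp‖ ≤ bumpBound (coreBump (E := 𝔼 3)) / ρ :=
        (ContinuousLinearMap.opNorm_comp_le _ _).trans (by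
          calc ‖fderiv ℝ (cutAt coreBump ρ) (axisPerp y)‖ * ‖axisPerp‖
              ≤ bumpBound (coreBump (E := 𝔼 3)) / ρ * 1 :=
                mul_le_mul (norm_fderiv_cutAt_le coreBump hρ _) opNorm_axisPerp_le (norm_nonneg _)
                  (div_nonneg hC hρ.le)
            _ = bumpBound (coreBump (E := 𝔼 3)) / ρ := mul_one _)
      calc ‖(fderiv ℝ (cutAt coreBump ρ) (axisPerp y)).comp axisPerp‖ * ‖L y - y‖
          ≤ (bumpBound (coreBump (E := 𝔼 3)) / ρ) * (‖L - 1‖ * (ρ * (17 / 5))) := by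
            refine mul_le_mul h3 ((hL.norm_sub_apply_le y).trans ?_) (norm_nonneg _) (div_nonneg hC hρ.le)
            exact mul_le_mul_of_nonneg_left hy (norm_nonneg _)
        _ = bumpBound (coreBump (E := 𝔼 3)) * (17 / 5) * ‖L - 1‖ := by
            field_simp
    calc ‖cutAt coreBump ρ (axisPerp y) • (L - ContinuousLinearMap.id ℝ (𝔼 3))‖ +
          ‖((fderiv ℝ (cutAt coreBump ρ) (axisPerp y)).comp axisPerp).smulRight (L y - y)‖
        ≤ ‖L - 1‖ + bumpBound (coreBump (E := 𝔼 3)) * (17 / 5) * ‖L - 1‖ := add_le_add h1 h2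
      _ = (1 + bumpBound (coreBump (E := 𝔼 3)) * (17 / 5)) * ‖L - 1‖ := by ring
  · have hy' : ρ * (coreBump (E := 𝔼 3)).rOut < ‖axisPerp y‖ := by rw [hOut]; exact not_le.1 hy
    rw [cutAt_eq_zero coreBump hρ hy'.le, fderiv_cutAt_eq_zero coreBump hρ hy']
    simp only [ContinuousLinearMap.zero_comp, ContinuousLinearMap.zero_smulRight, add_zero, norm_smul,
      norm_zero, zero_mul]
    positivity

/-- **The axial straightening of a near-identity axial operator is a diffeomorphism of `ℝ³`.** [cite: Hirsch1976, Ch. 8 §3, proof of Thm 3.1 (inserting a bump function)] -/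
def axialDiffeo (hρ : 0 < ρ) {L : 𝔼 3 →L[ℝ] 𝔼 3} (hL : IsAxial L)
    (hL1 : ‖L - 1‖ ≤ straightenThreshold (coreBump (E := 𝔼 3))) :
    𝔼 3 ≃ₘ⟮𝓘(ℝ, 𝔼 3), 𝓘(ℝ, 𝔼 3)⟯ 𝔼 3 :=
  Diffeomorph.ofNormFDerivSubIdLe (axialFun ρ L) (contDiff_axialFun ρ L) (by simp)
    fun y ↦ (norm_fderiv_axialFun_sub_id_le hρ hL y).trans (by
      have h0 : 0 < 1 + bumpBound (coreBump (E := 𝔼 3)) * (17 / 5) := by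
        have := bumpBound_nonneg (coreBump (E := 𝔼 3)); positivity
      have hOut : (coreBump (E := 𝔼 3)).rOut = 17 / 5 := rfl
      calc (1 + bumpBound (coreBump (E := 𝔼 3)) * (17 / 5)) * ‖L - 1‖
          ≤ (1 + bumpBound (coreBump (E := 𝔼 3)) * (17 / 5)) * straightenThreshold (coreBump (E := 𝔼 3)) :=
            mul_le_mul_of_nonneg_left hL1 h0.le
        _ = 1 / 2 := by
            have hb := bumpBound_nonneg (coreBump (E := 𝔼 3))
            have hne : (1 + bumpBound (coreBump (E := 𝔼 3)) * (17 / 5)) ≠ 0 := by positivity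
            unfold straightenThreshold
            rw [hOut]
            field_simp)

/-- The axial straightening diffeomorphism as a function (definitional). [folklore] -/
@[simp] theorem coe_axialDiffeo (hρ : 0 < ρ) {L : 𝔼 3 →L[ℝ] 𝔼 3} (hL : IsAxial L)
    (hL1 : ‖L - 1‖ ≤ straightenThreshold (coreBump (E := 𝔼 3))) : ⇑(axialDiffeo hρ hL hL1) = axialFun ρ L :=
  rfl

end Axial

/-! ### Iterated axial straightenings -/

section List

variable {ρ : ℝ}

/-- **Iterated axial straightening** of the operators of a list, all at the same scale `ρ`. [cite: Hirsch1976, Ch. 8 §3, proof of Thm 3.1 (inserting a bump function)] -/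
def axialListFun (ρ : ℝ) : List (𝔼 3 →L[ℝ] 𝔼 3) → 𝔼 3 → 𝔼 3
  | [] => id
  | L :: l => axialFun ρ L ∘ axialListFun ρ l

/-- The iterated axial straightening of the empty list is the identity. [folklore] -/
@[simp] theorem axialListFun_nil : axialListFun ρ [] = id := rfl

/-- The iterated axial straightening of `L :: l`. [folklore] -/
theorem axialListFun_cons (L : 𝔼 3 →L[ℝ] 𝔼 3) (l : List (𝔼 3 →L[ℝ] 𝔼 3)) :
    axialListFun ρ (L :: l) = axialFun ρ L ∘ axialListFun ρ l := rfl

/-- The iterated axial straightening fixes `0`. [folklore] -/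
@[simp] theorem axialListFun_apply_zero (l : List (𝔼 3 →L[ℝ] 𝔼 3)) : axialListFun ρ l 0 = 0 := by
  induction l with
  | nil => rfl
  | cons L l ih => rw [axialListFun_cons, comp_apply, ih, axialFun_apply_zero]

/-- The iterated axial straightening of a list of identity operators is the identity. [folklore] -/
theorem axialListFun_eq_id_of_forall_eq_one {l : List (𝔼 3 →L[ℝ] 𝔼 3)} (h : ∀ L ∈ l, L = 1) :
    axialListFun ρ l = id := by
  induction l with
  | nil => rfl
  | cons L l ih =>
    rw [axialListFun_cons, ih fun M hM ↦ h M (List.mem_cons_of_mem _ hM), h L List.mem_cons_self,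
      axialFun_one]
    rfl

/-- **The iterated axial straightening commutes with the translations along the axis** (axial
factors). [folklore] -/
theorem axialListFun_add_smul_axisVec {l : List (𝔼 3 →L[ℝ] 𝔼 3)} (hl : ∀ L ∈ l, IsAxial L) (y : 𝔼 3) (c : ℝ) :
    axialListFun ρ l (y + c • axisVec) = axialListFun ρ l y + c • axisVec := by
  induction l with
  | nil => rfl
  | cons L l ih =>
    rw [axialListFun_cons, comp_apply, comp_apply, ih fun M hM ↦ hl M (List.mem_cons_of_mem _ hM),
      axialFun_add_smul_axisVec (hl L List.mem_cons_self)]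

variable (hρ : 0 < ρ)
include hρ

/-- **Off the tube of radius `(17/5) ρ` the iterated axial straightening is the identity.** [folklore] -/
theorem axialListFun_of_le_norm (l : List (𝔼 3 →L[ℝ] 𝔼 3)) {y : 𝔼 3} (hy : ρ * (17 / 5) ≤ ‖axisPerp y‖) :
    axialListFun ρ l y = y := by
  induction l with
  | nil => rfl
  | cons L l ih =>
    rw [axialListFun_cons, comp_apply, ih]
    exact axialFun_of_le_norm hρ _ hy

/-- **The iterated axial straightening preserves the tubes of radius at least `(7/6)(17/5) ρ`.** [folklore] -/
theorem norm_axisPerp_axialListFun_le_max {l : List (𝔼 3 →L[ℝ] 𝔼 3)} (hl : ∀ L ∈ l, IsAxial L)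
    (h1 : ∀ L ∈ l, ‖L - 1‖ ≤ 1 / 6) (y : 𝔼 3) :
    ‖axisPerp (axialListFun ρ l y)‖ ≤ max ‖axisPerp y‖ ((7 / 6) * (ρ * (17 / 5))) := by
  induction l with
  | nil => exact le_max_left _ _
  | cons L l ih =>
    rw [axialListFun_cons, comp_apply]
    refine (norm_axisPerp_axialFun_le_max hρ (hl L List.mem_cons_self) (h1 L List.mem_cons_self) _).trans ?_
    exact max_le ((ih (fun M hM ↦ hl M (List.mem_cons_of_mem _ hM))
      fun M hM ↦ h1 M (List.mem_cons_of_mem _ hM))) (le_max_right _ _)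

/-- **On the tube of radius `3ρ (6/7)^{|l|}` the iterated axial straightening is the product
operator** (axial factors of norm `≤ 7/6`: each partial product keeps the point inside the tube of
radius `3ρ` where the next factor is linear). [folklore] -/
theorem axialListFun_of_norm_le {l : List (𝔼 3 →L[ℝ] 𝔼 3)} (hl : ∀ L ∈ l, IsAxial L)
    (h : ∀ L ∈ l, ‖L‖ ≤ 7 / 6) {y : 𝔼 3} (hy : ‖axisPerp y‖ ≤ ρ * 3 * (6 / 7) ^ l.length) :
    axialListFun ρ l y = l.prod y := by
  induction l generalizing y with
  | nil => rw [List.prod_nil]; rfl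
  | cons L l ih =>
    have hl' : ∀ M ∈ l, IsAxial M := fun M hM ↦ hl M (List.mem_cons_of_mem _ hM)
    have h' : ∀ M ∈ l, ‖M‖ ≤ 7 / 6 := fun M hM ↦ h M (List.mem_cons_of_mem _ hM)
    rw [List.length_cons, pow_succ] at hy
    have hy' : ‖axisPerp y‖ ≤ ρ * 3 * (6 / 7) ^ l.length := by
      refine hy.trans ?_
      rw [← mul_assoc]
      exact mul_le_of_le_one_right (by positivity) (by norm_num)
    rw [axialListFun_cons, comp_apply, ih hl' h' hy', List.prod_cons]
    show axialFun ρ L (l.prod y) = L (l.prod y)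
    apply axialFun_of_norm_le hρ
    have hρ3 : 0 ≤ ρ * 3 := by positivity
    calc ‖axisPerp (l.prod y)‖ ≤ (7 / 6) ^ l.length * ‖axisPerp y‖ := norm_axisPerp_list_prod_le hl' h' y
      _ ≤ (7 / 6) ^ l.length * (ρ * 3 * ((6 / 7) ^ l.length * (6 / 7))) :=
          mul_le_mul_of_nonneg_left hy (by positivity)
      _ = ρ * 3 * (6 / 7) * ((7 / 6) * (6 / 7)) ^ l.length := by rw [mul_pow]; ring
      _ ≤ ρ * 3 := by norm_num; linarith

/-- **On the tube of radius `3ρ` the iterated axial straightening of contracting axial factors is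
the product operator** (no loss of radius: contractions keep the tube). [folklore] -/
theorem axialListFun_of_norm_le_of_contracting {l : List (𝔼 3 →L[ℝ] 𝔼 3)} (hl : ∀ L ∈ l, IsAxial L)
    (h : ∀ L ∈ l, ‖L‖ ≤ 1) {y : 𝔼 3} (hy : ‖axisPerp y‖ ≤ ρ * 3) : axialListFun ρ l y = l.prod y := by
  induction l generalizing y with
  | nil => rw [List.prod_nil]; rfl
  | cons L l ih =>
    have hl' : ∀ M ∈ l, IsAxial M := fun M hM ↦ hl M (List.mem_cons_of_mem _ hM)
    have h' : ∀ M ∈ l, ‖M‖ ≤ 1 := fun M hM ↦ h M (List.mem_cons_of_mem _ hM)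
    rw [axialListFun_cons, comp_apply, ih hl' h' hy, List.prod_cons]
    show axialFun ρ L (l.prod y) = L (l.prod y)
    exact axialFun_of_norm_le hρ _ ((norm_axisPerp_list_prod_le_of_contracting hl' h' y).trans hy)

/-- **The iterated axial straightening is a diffeomorphism** when all factors are axial and within
the straightening threshold of the identity. [folklore] -/
theorem exists_diffeomorph_axialListFun {l : List (𝔼 3 →L[ℝ] 𝔼 3)} (hl : ∀ L ∈ l, IsAxial L)
    (h : ∀ L ∈ l, ‖L - 1‖ ≤ straightenThreshold (coreBump (E := 𝔼 3))) :
    ∃ D : 𝔼 3 ≃ₘ⟮𝓘(ℝ, 𝔼 3), 𝓘(ℝ, 𝔼 3)⟯ 𝔼 3, ⇑D = axialListFun ρ l := by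
  induction l with
  | nil => exact ⟨Diffeomorph.refl _ _ _, rfl⟩
  | cons L l ih =>
    obtain ⟨D, hD⟩ := ih (fun M hM ↦ hl M (List.mem_cons_of_mem _ hM))
      fun M hM ↦ h M (List.mem_cons_of_mem _ hM)
    refine ⟨D.trans (axialDiffeo hρ (hl L List.mem_cons_self) (h L List.mem_cons_self)), ?_⟩
    rw [Diffeomorph.coe_trans, coe_axialDiffeo, hD, axialListFun_cons]

end List

/-! ### The axial path: a jointly smooth family of tube-supported diffeomorphisms -/

section Path

variable {ρ : ℝ}

/-- **The axial path**: the iterated axial straightening of the segment list at time `t`,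
`y ↦ S_{1 + λ(t)(N_1 - 1)} ∘ ⋯ ∘ S_{1 + λ(t)(N_m - 1)} (y)`. [cite: Hirsch1976, Ch. 8 §3, proof of Thm 3.1 (inserting a bump function)] -/
def axialPathFun (ρ : ℝ) (l : List (𝔼 3 →L[ℝ] 𝔼 3)) (t : ℝ) : 𝔼 3 → 𝔼 3 :=
  axialListFun ρ (segList l t)

/-- The axial path of `N :: l`. [folklore] -/
theorem axialPathFun_cons (N : 𝔼 3 →L[ℝ] 𝔼 3) (l : List (𝔼 3 →L[ℝ] 𝔼 3)) (t : ℝ) :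
    axialPathFun ρ (N :: l) t = axialFun ρ (segOp (Real.smoothTransition t) N) ∘ axialPathFun ρ l t := by
  rw [axialPathFun, segList_cons, axialListFun_cons, axialPathFun]

/-- **At `t = 0` the axial path is the identity.** [folklore] -/
@[simp] theorem axialPathFun_zero (ρ : ℝ) (l : List (𝔼 3 →L[ℝ] 𝔼 3)) : axialPathFun ρ l 0 = id :=
  axialListFun_eq_id_of_forall_eq_one fun _ hL ↦ eq_one_of_mem_segList_zero l hL

/-- The axial path fixes `0`. [folklore] -/
@[simp] theorem axialPathFun_apply_zero (ρ : ℝ) (l : List (𝔼 3 →L[ℝ] 𝔼 3)) (t : ℝ) :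
    axialPathFun ρ l t 0 = 0 :=
  axialListFun_apply_zero _

/-- **The axial path is jointly smooth in `(t, y)`.** [folklore] -/
theorem contDiff_axialPathFun_uncurry (ρ : ℝ) (l : List (𝔼 3 →L[ℝ] 𝔼 3)) :
    ContDiff ℝ ∞ (uncurry (axialPathFun ρ l)) := by
  induction l with
  | nil => exact contDiff_snd
  | cons N l ih =>
    have h : uncurry (axialPathFun ρ (N :: l)) = fun p : ℝ × (𝔼 3) ↦
        axialFun ρ (segOp (Real.smoothTransition p.1) N) (uncurry (axialPathFun ρ l) p) := by
      funext p
      rw [uncurry, axialPathFun_cons]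
      rfl
    rw [h]
    exact (contDiff_axialFun_uncurry ρ).comp
      ((((contDiff_segOp N).comp Real.smoothTransition.contDiff).comp contDiff_fst).prodMk ih)

/-- **The axial path commutes with the translations along the axis** (axial factors). [folklore] -/
theorem axialPathFun_add_smul_axisVec {l : List (𝔼 3 →L[ℝ] 𝔼 3)} (hl : ∀ L ∈ l, IsAxial L) (t : ℝ)
    (y : 𝔼 3) (c : ℝ) : axialPathFun ρ l t (y + c • axisVec) = axialPathFun ρ l t y + c • axisVec :=
  axialListFun_add_smul_axisVec (isAxial_of_mem_segList hl t) y c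

variable (hρ : 0 < ρ)
include hρ

/-- **Off the tube of radius `(17/5) ρ` every stage of the axial path is the identity.** [folklore] -/
theorem axialPathFun_of_le_norm (l : List (𝔼 3 →L[ℝ] 𝔼 3)) (t : ℝ) {y : 𝔼 3}
    (hy : ρ * (17 / 5) ≤ ‖axisPerp y‖) : axialPathFun ρ l t y = y :=
  axialListFun_of_le_norm hρ _ hy

/-- **Every stage of the axial path preserves the tubes of radius at least `(7/6)(17/5) ρ`**
(axial factors within `1/6` of `1`). [folklore] -/
theorem norm_axisPerp_axialPathFun_le_max {l : List (𝔼 3 →L[ℝ] 𝔼 3)} (hl : ∀ L ∈ l, IsAxial L)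
    (h : ∀ N ∈ l, ‖N - 1‖ ≤ 1 / 6) (t : ℝ) (y : 𝔼 3) :
    ‖axisPerp (axialPathFun ρ l t y)‖ ≤ max ‖axisPerp y‖ ((7 / 6) * (ρ * (17 / 5))) :=
  norm_axisPerp_axialListFun_le_max hρ (isAxial_of_mem_segList hl t) (norm_sub_one_le_of_mem_segList h t) y

/-- **Every stage of the axial path is a diffeomorphism** (axial factors within the straightening
threshold of `1`). [folklore] -/
theorem exists_diffeomorph_axialPathFun {l : List (𝔼 3 →L[ℝ] 𝔼 3)} (hl : ∀ L ∈ l, IsAxial L)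
    (h : ∀ N ∈ l, ‖N - 1‖ ≤ straightenThreshold (coreBump (E := 𝔼 3))) (t : ℝ) :
    ∃ D : 𝔼 3 ≃ₘ⟮𝓘(ℝ, 𝔼 3), 𝓘(ℝ, 𝔼 3)⟯ 𝔼 3, ⇑D = axialPathFun ρ l t :=
  exists_diffeomorph_axialListFun hρ (isAxial_of_mem_segList hl t) (norm_sub_one_le_of_mem_segList h t)

omit hρ in
/-- Members of a segment list within `1/6` of `1` have norm at most `7/6`. [folklore] -/
theorem norm_le_of_mem_segList {l : List (𝔼 3 →L[ℝ] 𝔼 3)} (h : ∀ N ∈ l, ‖N - 1‖ ≤ 1 / 6) (t : ℝ) :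
    ∀ L ∈ segList l t, ‖L‖ ≤ 7 / 6 := fun L hL ↦ by
  have h1 : ‖L - 1‖ ≤ 1 / 6 := norm_sub_one_le_of_mem_segList h t L hL
  calc ‖L‖ = ‖L - 1 + 1‖ := by rw [sub_add_cancel]
    _ ≤ ‖L - 1‖ + ‖(1 : 𝔼 3 →L[ℝ] 𝔼 3)‖ := norm_add_le _ _
    _ ≤ 1 / 6 + 1 := add_le_add h1 ContinuousLinearMap.norm_id_le
    _ = 7 / 6 := by norm_num

/-- **On the tube of radius `3ρ (6/7)^m` the stage at time `t` is the segment product** (axial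
factors within `1/6` of `1`). [folklore] -/
theorem axialPathFun_of_norm_le {l : List (𝔼 3 →L[ℝ] 𝔼 3)} (hl : ∀ L ∈ l, IsAxial L)
    (h : ∀ N ∈ l, ‖N - 1‖ ≤ 1 / 6) (t : ℝ) {y : 𝔼 3} (hy : ‖axisPerp y‖ ≤ ρ * 3 * (6 / 7) ^ l.length) :
    axialPathFun ρ l t y = segProd l t y := by
  rw [axialPathFun, axialListFun_of_norm_le hρ (isAxial_of_mem_segList hl t) (norm_le_of_mem_segList h t)
    (by rwa [length_segList])]
  rfl

omit hρ in
/-- **Segment operators of contractions are contractions**: `‖(1 - κ) 1 + κ N‖ ≤ 1` for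
`κ ∈ [0, 1]`, `‖N‖ ≤ 1`. [folklore] -/
theorem norm_le_one_of_mem_segList {l : List (𝔼 3 →L[ℝ] 𝔼 3)} (h : ∀ N ∈ l, ‖N‖ ≤ 1) (t : ℝ) :
    ∀ L ∈ segList l t, ‖L‖ ≤ 1 := fun L hL ↦ by
  obtain ⟨N, hN, rfl⟩ := List.mem_map.1 hL
  have hκ0 : 0 ≤ Real.smoothTransition t := Real.smoothTransition.nonneg t
  have hκ1 : Real.smoothTransition t ≤ 1 := Real.smoothTransition.le_one t
  have heq : segOp (Real.smoothTransition t) N =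
      (1 - Real.smoothTransition t) • (1 : 𝔼 3 →L[ℝ] 𝔼 3) + Real.smoothTransition t • N := by
    rw [segOp]
    module
  rw [heq]
  calc ‖(1 - Real.smoothTransition t) • (1 : 𝔼 3 →L[ℝ] 𝔼 3) + Real.smoothTransition t • N‖
      ≤ ‖(1 - Real.smoothTransition t) • (1 : 𝔼 3 →L[ℝ] 𝔼 3)‖ + ‖Real.smoothTransition t • N‖ := norm_add_le _ _
    _ ≤ (1 - Real.smoothTransition t) * 1 + Real.smoothTransition t * 1 := by
        rw [norm_smul, norm_smul, Real.norm_of_nonneg (by linarith), Real.norm_of_nonneg hκ0]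
        exact add_le_add (mul_le_mul_of_nonneg_left ContinuousLinearMap.norm_id_le (by linarith))
          (mul_le_mul_of_nonneg_left (h N hN) hκ0)
    _ = 1 := by ring

/-- **On the tube of radius `3ρ` the stage at time `t` of contracting axial factors is the segment
product** (no loss of radius). [folklore] -/
theorem axialPathFun_of_norm_le_of_contracting {l : List (𝔼 3 →L[ℝ] 𝔼 3)} (hl : ∀ L ∈ l, IsAxial L)
    (h : ∀ N ∈ l, ‖N‖ ≤ 1) (t : ℝ) {y : 𝔼 3} (hy : ‖axisPerp y‖ ≤ ρ * 3) :
    axialPathFun ρ l t y = segProd l t y := by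
  rw [axialPathFun, axialListFun_of_norm_le_of_contracting hρ (isAxial_of_mem_segList hl t)
    (norm_le_one_of_mem_segList h t) hy]
  rfl

end Path

/-! ### The axial diffeotopy of `ℝ³` and of `T³` -/

section Diffeotopy

variable {ρ : ℝ} (hρ : 0 < ρ) (l : List (𝔼 3 →L[ℝ] 𝔼 3)) (hl : ∀ L ∈ l, IsAxial L)
  (hth : ∀ N ∈ l, ‖N - 1‖ ≤ straightenThreshold (coreBump (E := 𝔼 3)))
  (h6 : ∀ N ∈ l, ‖N - 1‖ ≤ 1 / 6)

/-- **The axial diffeotopy of `ℝ³`** of a list of near-identity axial operators at scale `ρ`. [cite: Hirsch1976, Ch. 8 §1 (diffeotopies) and §3 (proof of Thm 3.1)] -/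
def axialDiffeotopy : Diffeotopy 𝓘(ℝ, 𝔼 3) (𝔼 3) :=
  Diffeotopy.ofFamily (axialPathFun ρ l) (contDiff_axialPathFun_uncurry ρ l)
    (exists_diffeomorph_axialPathFun hρ hl hth) (axialPathFun_zero ρ l)

/-- Stages of the axial diffeotopy of `ℝ³` (definitional). [folklore] -/
@[simp] theorem axialDiffeotopy_toFun : (axialDiffeotopy hρ l hl hth).toFun = axialPathFun ρ l := rfl

include hρ hl h6 in
/-- `(7/6)(17/5) < 4`: the stages preserve the tube of radius `4ρ`. [folklore] -/
theorem sq_add_sq_axialPathFun_lt (t : ℝ) {v : 𝔼 3} (hv : v 1 ^ 2 + v 2 ^ 2 < (ρ * 4) ^ 2) :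
    (axialPathFun ρ l t v) 1 ^ 2 + (axialPathFun ρ l t v) 2 ^ 2 < (ρ * 4) ^ 2 := by
  rw [← norm_axisPerp_sq] at hv ⊢
  have h1 : ‖axisPerp v‖ < ρ * 4 := (abs_lt_of_sq_lt_sq' hv (by positivity)).2
  have h2 : ‖axisPerp (axialPathFun ρ l t v)‖ < ρ * 4 := by
    refine (norm_axisPerp_axialPathFun_le_max hρ hl h6 t v).trans_lt (max_lt h1 ?_)
    nlinarith
  exact pow_lt_pow_left₀ h2 (norm_nonneg _) two_ne_zero

include hρ in
/-- Off the tube of radius `4ρ` the stages are the identity. [folklore] -/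
theorem axialPathFun_of_sq_le (t : ℝ) {v : 𝔼 3} (hv : (ρ * 4) ^ 2 ≤ v 1 ^ 2 + v 2 ^ 2) :
    axialPathFun ρ l t v = v := by
  rw [← norm_axisPerp_sq] at hv
  have h1 : ρ * 4 ≤ ‖axisPerp v‖ := (abs_le_of_sq_le_sq' hv (norm_nonneg _)).2
  exact axialPathFun_of_le_norm hρ l t (by linarith)

variable (hρπ : ρ * 4 < π)

/-- **The axial diffeotopy of `T³`**: the tube extension (`Diffeotopy.torusExtendTube`, tube radius
`4ρ < π`) of the axial diffeotopy of `ℝ³`. [cite: Hirsch1976, Ch. 8 §3, proof of Thm 3.1 (inserting a bump function)] -/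
def torusAxialDiffeotopy : Diffeotopy 𝓣 ThreeTorus :=
  (axialDiffeotopy hρ l hl hth).torusExtendTube (R := ρ * 4) hρπ (by positivity)
    (fun t v hv ↦ axialPathFun_of_sq_le hρ l t hv)
    (fun t v c ↦ axialPathFun_add_smul_axisVec hl t v c)
    (fun t v hv ↦ sq_add_sq_axialPathFun_lt hρ l hl h6 t hv)

/-- Every stage of the axial diffeotopy of `T³` fixes the base point. [folklore] -/
theorem torusAxialDiffeotopy_based (t : ℝ) : (torusAxialDiffeotopy hρ l hl hth h6 hρπ).toFun t 1 = 1 :=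
  torusPush_one (axialPathFun_apply_zero ρ l t)

/-- **The axial diffeotopy of `T³` in exponential coordinates.** [folklore] -/
theorem torusAxialDiffeotopy_toFun_expT (t : ℝ) {v : 𝔼 3} (hv : ∀ j, |v j| < π) :
    (torusAxialDiffeotopy hρ l hl hth h6 hρπ).toFun t (expT v) = expT (axialPathFun ρ l t v) :=
  torusPush_expT _ hv

/-- The inverse stages of the axial diffeotopy of `T³` in exponential coordinates. [folklore] -/
theorem torusAxialDiffeotopy_invFun_expT (t : ℝ) {v : 𝔼 3} (hv : ∀ j, |v j| < π) :
    (torusAxialDiffeotopy hρ l hl hth h6 hρπ).invFun t (expT v) =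
      expT ((axialDiffeotopy hρ l hl hth).invFun t v) :=
  torusPush_expT _ hv

/-- **On the tube of radius `3ρ (6/7)^m` (and inside the chart) the stages of the axial diffeotopy
of `T³` are exactly linear with operator `segProd l t`.** [folklore] -/
theorem torusAxialDiffeotopy_toFun_expT_of_norm_le (t : ℝ) {v : 𝔼 3} (hv : ∀ j, |v j| < π)
    (hy : ‖axisPerp v‖ ≤ ρ * 3 * (6 / 7) ^ l.length) :
    (torusAxialDiffeotopy hρ l hl hth h6 hρπ).toFun t (expT v) = expT (segProd l t v) := by
  rw [torusAxialDiffeotopy_toFun_expT hρ l hl hth h6 hρπ t hv, axialPathFun_of_norm_le hρ hl h6 t hy]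

include h6 in
/-- **The inverse stages of the axial diffeotopy of `ℝ³` are exactly linear with operator
`segProdInv l t`** at the points `v` with `segProdInv l t v` in the tube of radius `3ρ (6/7)^m`. [folklore] -/
theorem axialDiffeotopy_invFun_eq (t : ℝ) {v : 𝔼 3}
    (hy : ‖axisPerp (segProdInv l t v)‖ ≤ ρ * 3 * (6 / 7) ^ l.length) :
    (axialDiffeotopy hρ l hl hth).invFun t v = segProdInv l t v := by
  have h1 : (axialDiffeotopy hρ l hl hth).toFun t (segProdInv l t v) = v := by
    rw [axialDiffeotopy_toFun, axialPathFun_of_norm_le hρ hl h6 t hy, segProd_segProdInv_apply h6 t v]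
  conv_lhs => rw [← h1]
  exact (axialDiffeotopy hρ l hl hth).invFun_toFun t _

/-- **The inverse stages of the axial diffeotopy of `T³` in exponential coordinates** at the points
`v` of the chart with `segProdInv l t v` in the tube of radius `3ρ (6/7)^m`. [folklore] -/
theorem torusAxialDiffeotopy_invFun_expT_of_norm_le (t : ℝ) {v : 𝔼 3} (hv : ∀ j, |v j| < π)
    (hy : ‖axisPerp (segProdInv l t v)‖ ≤ ρ * 3 * (6 / 7) ^ l.length) :
    (torusAxialDiffeotopy hρ l hl hth h6 hρπ).invFun t (expT v) = expT (segProdInv l t v) := by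
  rw [torusAxialDiffeotopy_invFun_expT hρ l hl hth h6 hρπ t hv, axialDiffeotopy_invFun_eq hρ l hl hth h6 t hy]

/-- **Contracting factors: the stages of the axial diffeotopy of `T³` are exactly linear on the tube
of radius `3ρ`** (inside the chart). [folklore] -/
theorem torusAxialDiffeotopy_toFun_expT_of_contracting (h1 : ∀ N ∈ l, ‖N‖ ≤ 1) (t : ℝ) {v : 𝔼 3}
    (hv : ∀ j, |v j| < π) (hy : ‖axisPerp v‖ ≤ ρ * 3) :
    (torusAxialDiffeotopy hρ l hl hth h6 hρπ).toFun t (expT v) = expT (segProd l t v) := by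
  rw [torusAxialDiffeotopy_toFun_expT hρ l hl hth h6 hρπ t hv, axialPathFun_of_norm_le_of_contracting hρ hl h1 t hy]

/-- Contracting factors: the inverse stages in exponential coordinates on the points `v` of the
chart with `segProdInv l t v` in the tube of radius `3ρ`. [folklore] -/
theorem torusAxialDiffeotopy_invFun_expT_of_contracting (h1 : ∀ N ∈ l, ‖N‖ ≤ 1) (t : ℝ) {v : 𝔼 3}
    (hv : ∀ j, |v j| < π) (hy : ‖axisPerp (segProdInv l t v)‖ ≤ ρ * 3) :
    (torusAxialDiffeotopy hρ l hl hth h6 hρπ).invFun t (expT v) = expT (segProdInv l t v) := by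
  have h2 : (axialDiffeotopy hρ l hl hth).toFun t (segProdInv l t v) = v := by
    rw [axialDiffeotopy_toFun, axialPathFun_of_norm_le_of_contracting hρ hl h1 t hy,
      segProd_segProdInv_apply h6 t v]
  have h3 : (axialDiffeotopy hρ l hl hth).invFun t v = segProdInv l t v := by
    conv_lhs => rw [← h2]
    exact (axialDiffeotopy hρ l hl hth).invFun_toFun t _
  rw [torusAxialDiffeotopy_invFun_expT hρ l hl hth h6 hρπ t hv, h3]

end Diffeotopy

end Literature.Topology.FourManifolds
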